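import Summits.BirchSwinnertonDyer.BirchSwinnertonDyer.Theorems.GenusKolyvaginAtTwoMinimalTwinBSDTwoIdentityDoorCount
import Summits.BirchSwinnertonDyer.BirchSwinnertonDyer.Theorems.GenusKolyvaginAtTwoMinimalTwinBSDTwoTranspositionDoor
import Summits.BirchSwinnertonDyer.BirchSwinnertonDyer.Theorems.GenusKolyvaginAtTwoGenusPrimitiveSupplyAtTwoTwistMasterFrame
import Summits.BirchSwinnertonDyer.BirchSwinnertonDyer.Theorems.GenusKolyvaginAtTwoKramerParityOfFrame
import Summits.BirchSwinnertonDyer.BirchSwinnertonDyer.Theorems.GenusKolyvaginAtTwoGenusPrimitiveSupplyAtTwoRelaxedAtInfinityIndex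
import Summits.BirchSwinnertonDyer.BirchSwinnertonDyer.Theorems.GenusKolyvaginAtTwoGenusPrimitiveSupplyAtTwoArchimedeanKummerCard
import Summits.BirchSwinnertonDyer.BirchSwinnertonDyer.Theorems.GenusKolyvaginAtTwoGenusPrimitiveSupplyAtTwoArchimedeanCapstone
import Summits.BirchSwinnertonDyer.BirchSwinnertonDyer.Theorems.GenusKolyvaginAtTwoGenusPrimitiveSupplyAtTwoTwistMultiFrame
import HarnessLib

/-!
# Route `GenusKolyvaginAtTwo`, crux U₂ `MinimalTwinBSDTwo` (stmt-BirchSwinnertonDyer-22985), LINE 23 «twin_swap»: THE IDENTITY-PRIME DOOR, part 2 —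
# `#Sel₂(W^{(−ℓ)}) = 1` on the `Δ > 0` IDENTITY LOCUS at an identity prime `ℓ` with injective localisation on `Sel₂^{rel ∞}(W)` — UNCONDITIONAL

Seat `bsd-line-gk2-p2` g26 (PROVER seat 2/3, cell `bsd-f1-sign2`, LINE 23 holder), `--supports stmt-BirchSwinnertonDyer-22985` (helper; closes nothing).
THEOREMS ONLY (no definition, no named fact, no `sorry`); standard axioms; UNCONDITIONAL (Poitou–Tate with real places
`poitouTate_selmerStructure_duality_real_holds`, Tate's χ `GenusKolyLowering.localEP`, Kramer's framed congruence `GenusKolyKramer.isSquare_card_selmerGroup_mul_of_frame`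
and the master frame `exists_intertwining_master_frame` are tree theorems).  **BSD is NOT proved by this file; U₂ is NOT proved; nothing is closed.**

THE POINT (LINE 23's last declared residual).  On the identity locus of U₂ — `W/ℚ` globally minimal, `Δ_W > 0`, rank `1`, `#Sel₂(W) = 2`, `W(ℚ) ⊂ W⁰(ℝ)`
(every Selmer class trivial at `∞`) — the reversed twin-swap needs a `2`-Selmer-TRIVIAL rank-`0` twin `W^{(d_K)}`.  Silent frames give `#Sel₂ = 4`
(`Egg.natCard_selmerGroup_twin_of_silent`), two transposition primes are decided only up to `{1, 4}` (`GenusKolyTransp.twoTranspositionTwistLaw_card`),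
so v1.8/v1.9 DECLARED this locus residual (OFF′/OFF″).  Here: take `K = ℚ(√−ℓ)` with `ℓ ≡ 7 (8)` Heegner and `ℓ` an IDENTITY prime — the `2`-division
cubic splits completely mod `ℓ`, `#W(ℚ_ℓ)[2] = 4` (on `Δ > 0` every Heegner prime `≡ 7 (8)` is silent or identity: `(Δ/ℓ) = +1`).  Mazur–Rubin's method
at `T = {∞, ℓ}` with the ∞-RELAXED Selmer group `R = Sel₂^{rel ∞}(W)` (order `4` here, `GenusKolyArch.natCard_selmerGroupRelaxedAtInfinityAtTwo_eq_four_of_not_meetsEgg`)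
as pivot: `[H¹_{𝓚^{∞,ℓ}} : H¹_{𝓚_{∞,ℓ}}] = #𝓛_∞ · #W(ℚ_ℓ)[2] = 8` (part 1), `H¹_{𝓚_{∞,ℓ}} = 0` and `Sel(A_χ) ∩ R = 0` as soon as `loc_ℓ` is INJECTIVE on
`R` (Lemma 2.11 at `ℓ`), whence `#Sel₂(Wd) · #Sel₂(W) ∣ 4`, i.e. `#Sel₂(Wd) ∣ 2`; and Kramer's congruence for the framed identification with
`S = {∞, ℓ}` (both conditions transversal: `[𝓚_∞ : 0]·[𝓚_ℓ : 0] = 2 · 4`) makes `16 · #Sel₂(Wd)` a square: **`#Sel₂(Wd) = 1`**.  The injectivity is a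
ČEBOTAREV condition on `ℓ` (the two classes of `R` restrict to a basis of `W(ℚ_ℓ)/2`; density `6/16` among identity primes in the class `−ℓ ∈ ℚ_p^{×2}`,
`p ∣ 2N`) — the supply is part 3.  Tamagawa cost: `c_ℓ(Wd) = 1 + 3 = 4`, i.e. `ord₂ C(Wd) = ord₂ C(W) + 2` (the cell's `Egg.padicValNat_add_two_le_…`:
at least two bits; here exactly two).

* `natCard_selmerGroup_twin_mul_dvd_four_and_isSquare_of_identityDoor` — `#Sel₂(Wd) · #Sel₂(W) ∣ 4` and `IsSquare (#Sel₂(Wd) · #Sel₂(W) · 8)`.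
* **`natCard_selmerGroup_twin_eq_one_of_identityDoor`** — with `#Sel₂(W) = 2`: `#Sel₂(Wd) = 1`.

References: [MazurRubin2010] Lemmas 2.9–2.11, Def. 3.1, Lemma 3.2, Prop. 3.3 (method; the printed Prop. 3.3 lets the real places split — the real
`T`-place is the cell's case); [Kramer1981] Props. 3, 6, Thm. 1; [KlagsbrunMazurRubin2013] Thm. 3.9, Lemma 5.2; [MilneADT2006] I Thm. 2.8, 2.13, 4.10;
[Howard2004HeegnerKolyvagin] Thm. 2.1.11.
-/

set_option linter.dupNamespace false -- tree convention: `Summit.BirchSwinnertonDyer.BirchSwinnertonDyer.Theorems` (summit = sub-problem)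
set_option autoImplicit false

noncomputable section

open scoped Classical ContRepresentation

open CategoryTheory Field Function NumberField IsDedekindDomain WeierstrassCurve
open Literature.NumberTheory.EllipticCurves
open Literature.NumberTheory.GaloisRepresentations
open Literature.NumberTheory.GaloisRepresentations.DiscreteGaloisModule (SelmerStructure)
open Literature.NumberTheory.GaloisCohomology
open Summit.BirchSwinnertonDyer.Rank1Residual
open Summit.BirchSwinnertonDyer.Rank1Residual.X11b.KummerPT (kummerRelaxed kummerStrict kummerRelaxed_of_mem kummerRelaxed_of_not_mem
  kummerStrict_of_mem kummerStrict_of_not_mem)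
open Summit.BirchSwinnertonDyer.Rank1Residual.X11b.CongruentTransfer
open Summit.BirchSwinnertonDyer.BirchSwinnertonDyer.Theorems.GenusKolyArch

namespace Summit.BirchSwinnertonDyer.BirchSwinnertonDyer.Theorems.GenusExact.TwinSwap.IdentityDoor

/-! ## §3 Over `ℚ`: the IDENTITY-PRIME DOOR — `#Sel₂(W^{(−ℓ)}) = 1` -/

section Rat

open Summit.BirchSwinnertonDyer.BirchSwinnertonDyer.Theorems.GenusKolyTwistLocal
open Literature.NumberTheory.GaloisRepresentations.IsNonarchimedeanLocalField (maxUnramified)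
open Summit.BirchSwinnertonDyer.BirchSwinnertonDyer.Theorems.SchneiderFreeAdditiveX3.PoitouTateReduction
  (poitouTate_selmerStructure_duality_real_holds)
open Summit.BirchSwinnertonDyer.Rank1Residual.F1Sign2 (selmerGroupRelaxedAtInfinityAtTwo)
open Summit.BirchSwinnertonDyer.BirchSwinnertonDyer.Theorems.GenusKolyTransp (selmerGroupRelaxedAtInfinityAtTwo_eq_kummerRelaxed)
open Rat.HeightOneSpectrum (primesEquiv)

variable (W : WeierstrassCurve ℚ) [W.IsElliptic] [W.IsGloballyMinimal] {K : Type} [Field K] [NumberField K]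

/-- **THE IDENTITY-PRIME DOOR over `ℚ` — the count and Kramer's congruence.**  `W/ℚ` globally minimal elliptic with `Δ_W > 0`; `K` imaginary
quadratic with `d_K = −ℓ` odd (`ℓ` prime), Heegner for `N_W`, `2` split; `ℓ` an IDENTITY prime (`#W(ℚ_ℓ)[2] = 4`, i.e. `W[2] ⊂ W(ℚ_ℓ)`); every
`2`-Selmer class of `W` trivial at `∞` (`Sel₂(W)` strict at `ℝ`: the identity locus, `¬ MeetsEgg`); and the localisation at `ℓ` INJECTIVE on the
∞-relaxed Selmer group `Sel₂^{rel ∞}(W)` (no non-zero class of it in `strictLocalKer_ℓ`).  Then for every elliptic model `Wd` of `W^{(d_K)}`: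
**`#Sel₂(Wd) · #Sel₂(W) ∣ 4`** (§2 with `T = {∞, ℓ}`: the place menu of a Heegner twin over `ℚ`, Lemma 2.11 at `ℓ`, `t_ℓ = 4`) **and
`#Sel₂(Wd) · #Sel₂(W) · 8` is a square** (Kramer's congruence for the framed identification with `S = {∞, ℓ}`: both local conditions transversal,
`[𝓚_∞ : 0] · [𝓚_ℓ : 0] = 2 · 4`).  UNCONDITIONAL (Poitou–Tate with real places and Tate's χ are tree theorems over `ℚ`).
[cite: MazurRubin2010, Lemmas 2.9–2.11, Lemma 3.2, Prop. 3.3 (method)] [cite: Kramer1981, Prop. 6, Thm. 1] [cite: MilneADT2006, I Thm. 2.8, 2.13, 4.10] -/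
theorem natCard_selmerGroup_twin_mul_dvd_four_and_isSquare_of_identityDoor (hΔ : 0 < W.Δ)
    (hK : IsImaginaryQuadratic K) (hodd : Odd (discr K)) (hH : SatisfiesHeegnerHypothesis (W.conductorNorm ℤ) K)
    (h2K : ((Ideal.span {(2 : ℤ)}).primesOver (𝓞 K)).ncard = 2)
    {ℓ : ℕ} [Fact ℓ.Prime] (hd : discr K = -(ℓ : ℤ))
    (hid : Nat.card {Q : (W.baseChange ℚ_[ℓ]).toAffine.Point // 2 • Q = 0} = 4)
    (hstr : ∀ c ∈ (W.kummerSelmerStructure ((2 : ℕ) : ℤ)).selmerGroup,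
      galoisCohomology.localization (W.torsionGaloisModule ((2 : ℕ) : ℤ)) (Sum.inl Rat.infinitePlace) 1 c = 0)
    (hinj : ∀ c ∈ selmerGroupRelaxedAtInfinityAtTwo W, c ∈ MazurRubin2010.strictLocalKer W ℚ_[ℓ] 2 → c = 0)
    (Wd : WeierstrassCurve ℚ) [Wd.IsElliptic] (hWd : ∃ C : VariableChange ℚ, C • W.quadraticTwist (discr K : ℚ) = Wd) :
    Nat.card (Wd.selmerGroup 2) * Nat.card (W.selmerGroup 2) ∣ 4 ∧
      IsSquare (Nat.card (Wd.selmerGroup 2) * Nat.card (W.selmerGroup 2) * 8) := by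
  haveI : Fact (Nat.Prime 2) := ⟨Nat.prime_two⟩
  have hℓ : ℓ.Prime := Fact.out
  obtain ⟨hℓ2, hℓN, -⟩ := GenusKolyTwin.prime_discr_facts W hK hodd hH hℓ hd
  have hPT := poitouTate_selmerStructure_duality_real_holds (K := ℚ)
  have hEP := GenusKolyLowering.localEP ℚ
  -- the place `v₀` of `ℚ` over `ℓ`
  obtain ⟨v₀, hv₀⟩ : ∃ v : HeightOneSpectrum (𝓞 ℚ), ((primesEquiv v : Nat.Primes) : ℕ) = ℓ :=
    ⟨primesEquiv.symm ⟨ℓ, hℓ⟩, by rw [Equiv.apply_symm_apply]⟩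
  have hℓv₀ : (ℓ : 𝓞 ℚ) ∈ v₀.asIdeal := by
    rw [← hv₀]
    exact Rat.HeightOneSpectrum.natCast_natGenerator_mem v₀
  obtain ⟨C, hC⟩ := hWd
  have hdneg : (discr K : ℚ) < 0 := by
    rw [hd]; push_cast
    exact neg_neg_of_pos (by exact_mod_cast hℓ.pos)
  have hd0 : (discr K : ℚ) ≠ 0 := hdneg.ne
  -- `W` good at `v₀`, `v₀ ∤ 2`
  have hW : W.HasGoodReductionAt v₀ := by
    by_contra h
    exact hℓN (hv₀ ▸ (W.dvd_conductorNorm_iff v₀).mpr h)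
  have h2v₀ : ((2 : ℕ) : 𝓞 ℚ) ∉ v₀.asIdeal :=
    GenusKolyTwistingPrime.natCast_not_mem_of_not_dvd hℓ hℓv₀ fun h ↦
      hℓ2 ((Nat.prime_dvd_prime_iff_eq hℓ Nat.prime_two).mp h)
  have h12 : (Sum.inl Rat.infinitePlace : Place ℚ) ≠ Sum.inr v₀ := Sum.inl_ne_inr
  -- the master datum: ONE identification with every local row and the frame
  obtain ⟨φ, ψ, hψφ, hφψ, hsplit, -, htr, hrtr, π, A, hπ, hA⟩ := exists_intertwining_master_frame W Wd hd0 hC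
  let 𝓐 : SelmerStructure (W.torsionGaloisModule ((2 : ℕ) : ℤ)) := fun v ↦
    (Wd.kummerSelmerStructure ((2 : ℕ) : ℤ) v).map (galoisCohomology.map (φ.restrictField (Place.Completion v)) 1)
  have h𝓐 : ∀ v, 𝓐 v = (Wd.kummerSelmerStructure ((2 : ℕ) : ℤ) v).map
      (galoisCohomology.map (φ.restrictField (Place.Completion v)) 1) := fun _ ↦ rfl
  -- agreement off `{∞, v₀}` (the place menu of a Heegner twin over `ℚ`)
  have hfin := twist_place_menu_finite_rat W hK.1 hH h2K hℓ hd hℓv₀ hC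
  have hagree : ∀ v : Place ℚ, v ≠ Sum.inl Rat.infinitePlace → v ≠ Sum.inr v₀ →
      𝓐 v = W.kummerSelmerStructure ((2 : ℕ) : ℤ) v := by
    rintro (w | v) hw hv
    · exact absurd (by rw [Subsingleton.elim w Rat.infinitePlace]) hw
    · have hvv₀ : v ≠ v₀ := fun h ↦ hv (by rw [h])
      rcases hfin v hvv₀ with ⟨s, hs⟩ | ⟨h2v, hvW, hvWd⟩ | ⟨h2v, h1W, h1Wd⟩
      · rw [h𝓐, kummerSelmerStructure_apply, kummerSelmerStructure_apply]
        exact hsplit (Place.Completion (Sum.inr v)) ⟨s, hs⟩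
      · exact transport_kummer_inr_eq_of_good W Wd 2 φ ψ hφψ 𝓐 h𝓐 h2v hvW hvWd
      · rw [h𝓐, kummerSelmerStructure_apply, kummerSelmerStructure_apply]
        exact map_kummerLocalConditionAt_adicCompletion_eq_of_natCard_ker_eq_one W Wd v two_ne_zero h2v h1W h1Wd φ
  have hagreeS : ∀ v ∉ ({(Sum.inl Rat.infinitePlace : Place ℚ), Sum.inr v₀} : Finset (Place ℚ)),
      𝓐 v = W.kummerSelmerStructure ((2 : ℕ) : ℤ) v := fun v hv ↦
    hagree v (fun h ↦ hv (by simp [h])) (fun h ↦ hv (by simp [h]))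
  -- Lemma 2.11 at `v₀`: `v₀(d_K) = 1`
  have hram : closureEmb (K := ℚ) (v₀.adicCompletion ℚ) (geomSqrt (discr K : ℚ)) ∉ maxUnramified (v₀.adicCompletion ℚ) := by
    apply GenusKolyTwistRamified.closureEmb_geomSqrt_not_mem_maxUnramified_rat v₀
    rw [hd]; push_cast
    exact GenusKolyTwistRamified.valuation_neg_natCast_eq_exp_neg_one_of_mem v₀ hℓ hℓv₀
  have htr₀ : 𝓐 (Sum.inr v₀) ⊓ W.kummerSelmerStructure ((2 : ℕ) : ℤ) (Sum.inr v₀) = ⊥ := by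
    rw [h𝓐, kummerSelmerStructure_apply, kummerSelmerStructure_apply]
    exact htr v₀ hW h2v₀ hram
  -- `t_ℓ = #W(ℚ_ℓ)[2] = 4`
  have hKv₀ : Nat.card (W.kummerSelmerStructure ((2 : ℕ) : ℤ) (Sum.inr v₀)) = 4 := by
    rw [W.natCard_kummerSelmerStructure_inr v₀ two_ne_zero, natCard_ker_nsmul_adicCompletion_eq_padic W v₀ 2,
      natCard_quotient_span_natCast_eq_one_of_not_mem v₀ h2v₀, mul_one]
    subst hv₀
    exact hid
  have ht : Nat.card (nsmulAddMonoidHom 2 : (W.baseChange (v₀.adicCompletion ℚ)).toAffine.Point →+ _).ker *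
      Nat.card (v₀.adicCompletionIntegers ℚ ⧸ Ideal.span {((2 : ℕ) : v₀.adicCompletionIntegers ℚ)}) = 4 := by
    rw [← W.natCard_kummerSelmerStructure_inr v₀ two_ne_zero]
    exact hKv₀
  refine ⟨?_, ?_⟩
  · -- THE COUNT (§2)
    have hinj' : ∀ c ∈ (kummerRelaxed W 2 {(Sum.inl Rat.infinitePlace : Place ℚ)}).selmerGroup,
        galoisCohomology.localization (W.torsionGaloisModule ((2 : ℕ) : ℤ)) (Sum.inr v₀) 1 c = 0 → c = 0 := by
      intro c hc h0
      rw [← selmerGroupRelaxedAtInfinityAtTwo_eq_kummerRelaxed] at hc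
      refine hinj c hc ?_
      have h1 : c ∈ W.torsionLocalKer (v₀.adicCompletion ℚ) ((2 : ℕ) : ℤ) :=
        (mem_torsionLocalKer_iff_localization_eq_zero_rat W v₀ c).mpr h0
      haveI := Fact.mk (primesEquiv v₀).2
      letI : Algebra ℚ (v₀.adicCompletion ℚ) := inferInstance
      haveI : CharZero (v₀.adicCompletion ℚ) :=
        Literature.NumberTheory.GaloisRepresentations.charZero_adicCompletion v₀
      have h2 := (GenusKolyTwistingPrime.mem_torsionLocalKer_padic_iff W
        (RingEquivClass.toRingEquiv (Rat.HeightOneSpectrum.adicCompletion.padicEquiv (R := 𝓞 ℚ) v₀)) ((2 : ℕ) : ℤ) c).mpr h1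
      subst hv₀
      exact h2
    -- `Sel₂(W)` is strict at `∞`, so it IS the strict group `H¹_{𝓚_{∞}}`
    have hStr : (kummerStrict W 2 {(Sum.inl Rat.infinitePlace : Place ℚ)}).selmerGroup =
        (W.kummerSelmerStructure ((2 : ℕ) : ℤ)).selmerGroup := by
      refine le_antisymm (selmerGroup_sandwich_kummer W 2 _).1 fun c hc ↦ ?_
      rw [SelmerStructure.mem_selmerGroup_iff]
      intro v
      by_cases hv : v ∈ ({(Sum.inl Rat.infinitePlace : Place ℚ)} : Finset (Place ℚ))
      · rw [kummerStrict_of_mem W 2 _ hv, Finset.mem_singleton.mp hv, hstr c hc]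
        exact zero_mem _
      · rw [kummerStrict_of_not_mem W 2 _ hv]
        exact (SelmerStructure.mem_selmerGroup_iff _ _).mp hc v
    have h := natCard_selmerGroup_mul_natCard_dvd_of_transverse_of_injective_relaxed W Wd 2 hPT hEP φ ψ hψφ hφψ 𝓐 h𝓐
      Rat.isReal_infinitePlace v₀ hagree htr₀ hinj'
    rw [ht, hStr, ← selmerGroup_eq_selmerGroup_kummerSelmerStructure] at h
    exact h
  · -- KRAMER'S CONGRUENCE for the framed identification, `S = {∞, v₀}`
    have hsq := GenusKolyKramer.isSquare_card_selmerGroup_mul_of_frame W Wd φ (Function.LeftInverse.injective hψφ) π hπ A hA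
      𝓐 h𝓐 {(Sum.inl Rat.infinitePlace : Place ℚ), Sum.inr v₀} hagreeS
    -- at `∞`: transversal (Kramer Prop. 6, `Δ > 0`, `d_K < 0`), `#𝓚_∞ = 2`
    have hrel_inf : (𝓐 (Sum.inl Rat.infinitePlace)).relIndex (W.kummerSelmerStructure ((2 : ℕ) : ℤ) (Sum.inl Rat.infinitePlace)) = 2 := by
      have htr_inf : 𝓐 (Sum.inl Rat.infinitePlace) ⊓ W.kummerSelmerStructure ((2 : ℕ) : ℤ) (Sum.inl Rat.infinitePlace) = ⊥ := by
        rw [h𝓐, kummerSelmerStructure_apply, kummerSelmerStructure_apply]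
        exact hrtr Rat.infinitePlace Rat.isReal_infinitePlace
          (by rw [embedding_of_isReal_rat_apply]; exact_mod_cast hΔ) (forall_sq_ne_completion_of_neg hdneg _)
      rw [← AddSubgroup.inf_relIndex_right, htr_inf, AddSubgroup.relIndex_bot_left]
      exact natCard_kummerSelmerStructure_inl_rat_eq_two_of_Δ_pos W hΔ _
    -- at `v₀`: transversal (Lemma 2.11), `#𝓚_{v₀} = 4`
    have hrel_v₀ : (𝓐 (Sum.inr v₀)).relIndex (W.kummerSelmerStructure ((2 : ℕ) : ℤ) (Sum.inr v₀)) = 4 := by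
      rw [← AddSubgroup.inf_relIndex_right, htr₀, AddSubgroup.relIndex_bot_left]
      exact hKv₀
    rw [Finset.prod_pair h12, hrel_inf, hrel_v₀] at hsq
    change IsSquare (Nat.card (Wd.selmerGroup 2) * Nat.card (W.selmerGroup 2) * (2 * 4)) at hsq
    simpa using hsq

/-- **THE IDENTITY-PRIME DOOR: `#Sel₂(W^{(−ℓ)}) = 1` on the identity locus — UNCONDITIONAL.**  `W/ℚ` globally minimal elliptic, `Δ_W > 0`,
`#Sel₂(W) = 2` with its class trivial at `∞` (`W(ℚ) ⊂ W⁰(ℝ)`: the cell's identity locus / descent sign `ε = −1`); `K = ℚ(√−ℓ)` with `d_K = −ℓ`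
odd, Heegner for `N_W`, `2` split; `ℓ` an IDENTITY prime (`#W(ℚ_ℓ)[2] = 4`) at which the ∞-relaxed Selmer group `Sel₂^{rel ∞}(W)` (order `4`,
`GenusKolyArch.natCard_selmerGroupRelaxedAtInfinityAtTwo_eq_four_of_not_meetsEgg`) localises INJECTIVELY.  Then EVERY model `Wd` of `W^{(d_K)}` has
**`#Sel₂(Wd) = 1`**: by the previous theorem `#Sel₂(Wd) ∣ 2` and `16 · #Sel₂(Wd)` is a square.  This is the reversed `2`-Selmer-TRIVIAL twin on the
identity locus that no silent prime (`Egg.natCard_selmerGroup_twin_of_silent`: `#Sel₂ = 4`) and no undecided two-transposition frame supplies; its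
Tamagawa cost is two bits (`c_ℓ(Wd) = 4`).  [cite: MazurRubin2010, Lemmas 2.9–2.11, 3.2, Prop. 3.3] [cite: Kramer1981, Prop. 3, Prop. 6, Thm. 1] -/
theorem natCard_selmerGroup_twin_eq_one_of_identityDoor (hΔ : 0 < W.Δ) (hSel : Nat.card (W.selmerGroup 2) = 2)
    (hK : IsImaginaryQuadratic K) (hodd : Odd (discr K)) (hH : SatisfiesHeegnerHypothesis (W.conductorNorm ℤ) K)
    (h2K : ((Ideal.span {(2 : ℤ)}).primesOver (𝓞 K)).ncard = 2)
    {ℓ : ℕ} [Fact ℓ.Prime] (hd : discr K = -(ℓ : ℤ))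
    (hid : Nat.card {Q : (W.baseChange ℚ_[ℓ]).toAffine.Point // 2 • Q = 0} = 4)
    (hstr : ∀ c ∈ (W.kummerSelmerStructure ((2 : ℕ) : ℤ)).selmerGroup,
      galoisCohomology.localization (W.torsionGaloisModule ((2 : ℕ) : ℤ)) (Sum.inl Rat.infinitePlace) 1 c = 0)
    (hinj : ∀ c ∈ selmerGroupRelaxedAtInfinityAtTwo W, c ∈ MazurRubin2010.strictLocalKer W ℚ_[ℓ] 2 → c = 0)
    (Wd : WeierstrassCurve ℚ) [Wd.IsElliptic] (hWd : ∃ C : VariableChange ℚ, C • W.quadraticTwist (discr K : ℚ) = Wd) :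
    Nat.card (Wd.selmerGroup 2) = 1 := by
  obtain ⟨hdvd, hsq⟩ := natCard_selmerGroup_twin_mul_dvd_four_and_isSquare_of_identityDoor W hΔ hK hodd hH h2K hd hid hstr hinj Wd hWd
  rw [hSel] at hdvd hsq
  have h2 : Nat.card (Wd.selmerGroup 2) ∣ 2 := by
    have h4 : (4 : ℕ) = 2 * 2 := by norm_num
    rw [h4] at hdvd
    exact Nat.dvd_of_mul_dvd_mul_right two_pos hdvd
  rcases (Nat.dvd_prime Nat.prime_two).mp h2 with h1 | h2'
  · exact h1
  · exfalso
    rw [h2'] at hsq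
    have h32 : IsSquare (2 ^ 5) := by simpa using hsq
    exact absurd ((isSquare_two_pow_iff_even 5).mp h32) (by decide)

end Rat

end Summit.BirchSwinnertonDyer.BirchSwinnertonDyer.Theorems.GenusExact.TwinSwap.IdentityDoor

end
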